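import Mathlib
import Summits.HodgeConjecture.HodgeConjecture.Theorems.PadicSemiregularLiftHodgeAbelianVarietiesCMPivotRationalRepresentation

/-!
# Crux `HodgeAbelianVarieties` (stmt-HodgeConjecture-1333), line `cm-pivot-andre` — André with CM targets, module L5a: eigenbasis and rational characteristic polynomial of a CM endomorphism

From the crux's CM typing `IsCM[A]` (an endomorphism `ψ` with `2 dim A` distinct eigenvalues `μ` on `H¹(A(ℂ); ℂ)`):
an eigenbasis `v` of `H¹(A(ℂ); ℂ)` (`ψ^* v_i = μ_i v_i`) and a RATIONAL polynomial whose complex roots are exactly the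
`μ_i` — the characteristic polynomial of `ψ` in the faithful rational representation
(`CMPivot.stub_rationalRepresentation`, landed). These are the inputs of module L1 (`exists_andreFieldData`).
-/

set_option linter.dupNamespace false

noncomputable section

namespace Summit.HodgeConjecture.HodgeConjecture.Theorems.HodgeAbelianVarieties.CMPivotAndre

open CategoryTheory Polynomial
open Literature.AlgebraicGeometry Literature.AlgebraicGeometry.Motives Literature.AlgebraicGeometry.HodgeTheory

/-- **Eigenbasis and rational characteristic polynomial.** If an endomorphism `ψ` of the complex abelian variety
`A` has `2 dim A` distinct eigenvalues `μ_i` on `H¹(A(ℂ); ℂ)`, then `H¹(A(ℂ); ℂ)` has a basis `v` with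
`ψ^* v_i = μ_i v_i`, and there is a rational polynomial `m` with `m = ∏ (X - μ_i)` over `ℂ` (the characteristic
polynomial of the rational representation of `ψ`). [cite: MumfordAV1970, §19 Thm. 3]
[cite: LangeBirkenhake1992, §1.1 Prop. 1.1.6] -/
theorem exists_eigenbasis_charpoly : ∀ (A : Literature.AlgebraicGeometry.Motives.AbelianVariety ℂ) (ψ : A ⟶ A) (μ : Fin (2 * A.dim) → ℂ), Function.Injective μ → (∀ i, Module.End.HasEigenvalue (Literature.AlgebraicGeometry.HodgeTheory.complexBetti.map ψ.hom.hom.hom 1).hom (μ i)) → ∃ v : Module.Basis (Fin (2 * A.dim)) ℂ (Literature.AlgebraicGeometry.HodgeTheory.complexBetti A.X 1), (∀ i, Literature.AlgebraicGeometry.HodgeTheory.complexBetti.map ψ.hom.hom.hom 1 (v i) = μ i • v i) ∧ ∃ m : Polynomial ℚ, m.map (algebraMap ℚ ℂ) = ∏ i, (Polynomial.X - Polynomial.C (μ i)) := by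
  intro A ψ μ hμ hev
  classical
  haveI := finite_complexBetti_abelianVariety A 1
  set T := (complexBetti.map ψ.hom.hom.hom 1).hom with hT
  -- eigenvectors, linearly independent, `2 dim A` of them: a basis
  have hx : ∀ i, ∃ x, Module.End.HasEigenvector T (μ i) x := fun i => (hev i).exists_hasEigenvector
  choose x hxv using hx
  have hli : LinearIndependent ℂ x := Module.End.eigenvectors_linearIndependent' T μ hμ x hxv
  have hcard : Fintype.card (Fin (2 * A.dim)) = Module.finrank ℂ (complexBetti A.X 1) := by
    rw [Fintype.card_fin, AbelianVariety.finrank_complexBetti_one]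
  let v : Module.Basis (Fin (2 * A.dim)) ℂ (complexBetti A.X 1) := basisOfLinearIndependentOfCardEqFinrank' x hli hcard
  have hv : ∀ i, v i = x i := fun i => by simp [v, coe_basisOfLinearIndependentOfCardEqFinrank']
  have hTv : ∀ i, T (v i) = μ i • v i := fun i => by
    rw [hv]; exact Module.End.mem_eigenspace_iff.mp (hxv i).1
  refine ⟨v, hTv, ?_⟩
  -- the rational representation gives a rational characteristic polynomial
  obtain ⟨b, σ, _, hσ⟩ := CMPivot.stub_rationalRepresentation A
  refine ⟨(σ (AbelianVariety.endAlgebra.of A ψ)).charpoly, ?_⟩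
  rw [← Matrix.charpoly_map, hσ ψ, Matrix.charpoly_transpose, LinearMap.charpoly_toMatrix, ← hT,
    ← LinearMap.charpoly_toMatrix T v]
  have hdiag : LinearMap.toMatrix v v T = Matrix.diagonal μ := by
    ext i j
    rw [LinearMap.toMatrix_apply, hTv, map_smul, v.repr_self, Finsupp.smul_apply, Finsupp.single_apply,
      Matrix.diagonal_apply]
    by_cases hij : i = j
    · subst hij; simp
    · simp [hij, Ne.symm hij]
  rw [hdiag, Matrix.charpoly_diagonal]

end Summit.HodgeConjecture.HodgeConjecture.Theorems.HodgeAbelianVarieties.CMPivotAndre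

end
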